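import Mathlib
import HarnessLib
import HarnessLib.Audit
import Summits.CriticalPhenomena.Statement
import Literature.Probability.RandomPlanarGeometry.ChordalCurveFamily
import Literature.Probability.RandomPlanarGeometry.CrossingCondition
import Literature.Probability.RandomPlanarGeometry.CritPercSLE
import HarnessLib.Audit.Status.Attr

/-!
Route: CardyScaleErgodic

Route CardyScaleErgodic (idea card scale-ergodic-quenched-upgrade). It suffices to show X =
QuenchedUpgrade ∧ ScaleStationaryEnsemble ∧ LimitExists:
(QuenchedUpgrade, crux r2) every probability measure ν on chordal curve FAMILIES P : DobrushinDomain
→ ProbabilityMeasure (CurveClass ℂ) that is invariant under the dilation flow (act_t P)(D) = (z ↦ t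
z)_* P(t⁻¹ D), t > 0, and is carried by families that are chordal, translation- and
rotation-covariant, domain-Markov, local, target-independent and Kemppainen–Smirnov G2-regular, is
carried by the SLE₆ family (ν-a.e. P, ∀ D, IsSLELaw 6 D (P D)) — the symmetry upgrade in QUENCHED
form: scale-STATIONARITY of the ensemble replaces the unproved scale-INVARIANCE of a single limit
(CardyRotToConf r3), i.e. "the dilation flow restricted to Euclidean local Markov families has no
invariant measure but the Dirac mass at its fixed point SLE₆ (no RG limit cycle)";
(ScaleStationaryEnsemble, crux r3) such a ν EXISTS and is tied to ℤ²: Krylov–Bogolyubov applied to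
the orbit δ ↦ (laws of the bond-ℤ² p = 1/2 exploration interfaces in all Dobrushin domains) in the
compact product of weak topologies (Aizenman–Burchard tightness) gives flow-invariant ν carried by
subsequential-limit families, every one of which is Euclidean-covariant (DKKMO rotation invariance +
lattice translations), local/Markov/target-independent (exact on the lattice, passed to the limit à
la Camia–Newman), G2 (KS17 §4.2 by RSW) and reproduces the cluster values of the ℤ² crossing
probabilities bondDomainCrossingProb R of every conformal rectangle;
(LimitExists, crux r4, shared with CardyUniqueLimit) the crossing probabilities converge for every
R.
Assembly (typed, provable now, checked in the planner sketch with
sle_six_measureReal_hitsBefore_holds): QuenchedUpgrade → ScaleStationaryEnsemble → LimitExists →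
CardyFormulaZ2, through the unconditional pay-off ClusterCardyZ2 (Cardy's value F(η_R) is a cluster
value at 0⁺ of δ ↦ bondDomainCrossingProb R δ for every R) and uniqueness of limits.
Lean (one line): Summit…CardyScaleErgodic.QuenchedUpgrade ∧ ScaleStationaryEnsemble ∧ (∀ R :
Literature.Probability.RandomPlanarGeometry.ConformalRectangle, ∃ L : ℝ, Filter.Tendsto
(Literature.Probability.Percolation.bondDomainCrossingProb R) (nhdsWithin 0 (Set.Ioi 0)) (nhds L)) →
CardyFormulaZ2.

Rationale: WHY THIS LINE. Every symmetry route to Cardy on ℤ² stalls on the non-compact symmetry: rotation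
invariance of subsequential limits is a theorem (DKKMO2020Rotational Thm 1.4, tree fact
dkkmo_rotation_invariance), scale invariance = uniqueness of the limit is open (CardyRotToConf r3,
CardyUniqueLimit X_U). This line manufactures dilation symmetry from COMPACTNESS instead of proving
it: the dilation flow acts continuously on the compact set Λ of subsequential limits
(SchrammSmirnov2011 §1; product of Prokhorov-compact interface laws, AizenmanBurchard1999), so
Krylov–Bogolyubov gives scale-STATIONARY ensembles ν on Λ for free — the analogue of Furstenberg2008
CP-chains / Hochman2010FractalDistributions fractal distributions obtained by log-scale Cesàro
averaging (area imported: ergodic theory of the magnification flow; dictionary: measure ↦ interface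
family, magnification flow ↦ act_t, CP-distribution ↦ ν, "ν-typical measure is uniformly scaling" ↦
ClusterCardyZ2 / CesaroCardyZ2). The symmetry upgrade (Schramm2000 principle +
LawlerSchrammWerner2001 locality ⇒ κ = 6, Werner2007 §3) is asked in QUENCHED form (r2); the pay-off
is unconditional: r2 ∧ r3 ⇒ ClusterCardyZ2 (typed glue PayoffGlue, proved in the planner sketch
modulo the cruxes), and the residual gap to the conjunct is exactly LimitExists with no symmetry
content (Tauberian remark: Cesàro convergence + log-scale uniform continuity does not give
convergence). No prior route or negative uses a dynamical system on the space of limits.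
RANKED CRUXES. #2 QuenchedUpgrade — every dilation-invariant Borel probability measure on chordal
families carried by chordal, rigid-motion-covariant, domain-Markov, local, target-independent,
G2-regular families is carried by the SLE₆ family (why it might fail: an RG limit cycle inside this
class is excluded by nothing known — log-periodic critical amplitudes exist in hierarchical models,
DerridaGiacomin2013; even the fixed-point case = CardyRotToConf r2 is open; sources Schramm2000,
LawlerSchrammWerner2001, KemppainenSmirnov2017, Hochman2010FractalDistributions). #3
ScaleStationaryEnsemble — such a measure exists, carried by ℤ² subsequential-limit families and tied
to the cluster values of bondDomainCrossingProb (why it might fail: Markov extension, G2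
inheritance, DKKMO loop→interface transfer and the crossing dictionary must hold for EVERY limit
point; sources KemppainenSmirnov2017 Thm 1.3 + §4.2, CamiaNewman2007 §§5–6, DKKMO2020Rotational,
AizenmanBurchard1999, GarbanPeteSchramm2013 §2). #4 LimitExists — shared with CardyUniqueLimit
(stmt-CriticalPhenomena-0747; why it might fail: only RSW bounds on cluster points, Grimmett1999
§11.10, BollobasRiordan2006 Ch. 7 Conj. 1).
SUPPORT. ClusterCardyZ2 (Cardy's value is a cluster value for every R: the first unconditional
theorem of the line), CesaroCardyZ2 (averaged Cardy formula from unique ergodicity), PayoffGlue (r2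
→ r3 → ClusterCardyZ2, provable now), Assembly (r2 → r3 → LimitExists → CardyFormulaZ2, provable
now; both checked in the planner sketch with sle_six_measureReal_hitsBefore_holds).
TWO-LAYER PLAN. Foreseen once r3 closes or r2 stalls: QuenchedUpgrade ⇐ FixedPointUpgrade (r2 for
Dirac masses = CardyRotToConf r2 in this vocabulary) → NoLimitCycle (every flow-invariant ν on the
class is carried by act-fixed families) → QuenchedUpgrade; ScaleStationaryEnsemble ⇐
OrbitCompactLimitsAreOneLimit (product-closure points are single full-plane limits) →
LimitsAreLocalMarkovG2 → EnsembleTie (hitsBefore dictionary) → ScaleStationaryEnsemble.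
KILL CRITERIA. ¬QuenchedUpgrade by an explicit scale-stationary non-conformal Euclidean local Markov
ensemble closes the route (close --reason refuted:QuenchedUpgrade) and is itself a Literature-grade
example; ¬ScaleStationaryEnsemble can only come from typed hygiene (junk coordinates, G2 not
inherited, G02 discretisation of wild Jordan domains) — pivot = restate, not close; ¬LimitExists
refutes the conjunct for every route; SLE6LimitZ2AllDiscretisations or CardyRotToConf r3 proved
elsewhere moots r3 (then ν = Dirac at the limit) but not r2.
NOT DECOMPOSED YET. The interiors of r2 and r3 (see TWO-LAYER PLAN); a Kingman/Birkhoff layer (exact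
arm exponents ν-a.s.) that a proof of r2 may want; SubseqCardyZ2 with ONE subsequence good for all R
(needs equicontinuity in R; the assembly does not need it); measurability/admissibility side
conditions (IsDiscretisation families are chosen inside r3's proof, not fixed in the statement).
Hygiene shared with the conjunct: G02 discretisation of wild Jordan domains (cf.
CardyUniqueLimit.NegDegenerateArcs).
CHEAPEST FALSIFIER. For r2: look for a translation-invariant 2-D percolation-type model with exact
DISCRETE scale invariance and RSW whose exploration is sharply domain-Markov and local but whose
crossing probabilities are log-periodic (a lacunary multiscale Boolean model fails the sharp Markov
property; a hierarchical-lattice example fails translation invariance — neither kills r2 as typed; a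
refuter should try to build one that does). For the pay-off: certified transfer-matrix crossing
probabilities of n × n squares of bond-ℤ² at n = 2^k, k ≤ 7 (kit): the Cesàro mean in k must
approach 1/2 = F(1/2) and, for 2:1 rectangles, F(η(2)) ≈ 0.1761 within RSW-scale errors; a drift
away would contradict CesaroCardyZ2 and Cardy itself (existing numerics, LPSA 1994, agree with Cardy
to 5e-3, so no kill expected). Not run here (plancard one-shot; kit not requested).
DEFINITION REQUESTS. None needed to state the items (ChordalFamily API, ConditionG2, IsSLELaw,
MarkedDomain.map, similarity exist); a Literature notion `QuadCrossingSpace` (SchrammSmirnov2011 ℋ_D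
with its compact metrizable topology and dilation action) would let r3's proof be organised at the
full-plane level — to be requested by the first prover of r3 if wanted.

Novelty: Nearest prior art: Furstenberg2008 (CP-chains: scale-stationary ergodic ensembles of measures by
log-scale Cesàro averaging) and Hochman2010FractalDistributions (arXiv:1008.3731: distributions
invariant under the magnification flow via Krylov–Bogolyubov along scales, with extra structure for
free); SchrammSmirnov2011 (arXiv:1101.5820: compactness, subsequential limits of any RSW percolation
incl. bond-ℤ²); the upgrade philosophy Schramm2000 + LawlerSchrammWerner2001 as in route
CardyRotToConf (whose r2 assumes exact similarity covariance and whose r3 = scale invariance is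
open). DELTA: the magnification-flow/CP-chain device is pointed at the space of subsequential
scaling limits of bond-ℤ² percolation interfaces (typed flow act_t on DobrushinDomain →
ProbabilityMeasure (CurveClass ℂ), Borel measures ν invariant under it): the open scale-invariance
crux becomes a theorem-sized existence statement (ScaleStationaryEnsemble) plus a QUENCHED upgrade
(QuenchedUpgrade) whose consequences are unconditional (ClusterCardyZ2, CesaroCardyZ2), and
LimitExists is isolated as the only remaining gap. Not found applied to percolation/SLE
identification anywhere. Self-grade new-combination (the card's refuter audit agreed).
Searches (2026-08-15, this planner): lit search --hybrid "scenery flow scale stationary ergodic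
percolation scaling limit subsequential" (12 generic hits, none on scale-averaging of limits);
zbmath "scenery flow fractal" → arXiv:0910.1956 (Hochman–Shmerkin), arXiv:1312.2567  [refs: 1008.3731, 1101.5820, 0910.1956, 1312.2567, 1008.3548, 1303.5971, 1206.1468, 2403.00432, Furstenberg2008, SchrammSmirnov2011, Schramm2000, LawlerSchrammWerner2001, KaenmakiSahlstenShmerkin2015, DerridaGiacomin2013, CostinGiacomin2012]

Barriers (technique_class: ergodic-scales scenery-flow symmetry-upgrade): technique_class: ergodic-scales scenery-flow symmetry-upgrade
- Literature.Barriers.CriticalPhenomena.EmbeddingModulusUniqueness (Beffara2008Universal Prop. 4):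
APPLIES to the line as to CardyRotToConf — scale-stationarity, Krylov–Bogolyubov, locality, domain
Markov, G2 and LimitExists are all shared by the stretched embeddings diag(1,p)·ℤ², so they cannot
by themselves single out the conformal modulus. Evasion (i) of the catalogue: the embedding-specific
input is ROTATION covariance of every limit family (DKKMO2020Rotational Thm 1.4, tree fact
dkkmo_rotation_invariance), which enters r3 (the ensemble is carried by rotation-covariant families)
and is a HYPOTHESIS of r2 (Euclid clause, ‖c‖ = 1); for p ≠ 1 the Euclid clause fails and the scheme
correctly yields nothing. LimitExists is existence-only (named as not blocked in the barrier text).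
- Literature.Barriers.CriticalPhenomena.ScaleCovarianceNotMoebius (3-D catalogue entry;
technique_class symmetry-upgrade): its moral — Euclidean + scale data alone do not force
conformality — applies verbatim to r2, which therefore carries the model-specific extra structure
the barrier's scope_caveats ask for: locality (LSW restriction form + target independence), the
domain Markov property and KS G2 regularity of the curve families; r2 is NOT "scale ⇒ conformal" for
correlation data but Schramm's principle run under scale-stationarity. Honest residue: no upgrade
theorem of this kind is proved even for exactly scale-invariant families (Car

sub-problem: CardyFormulaZ2 · status: blocked · opened planner-plancard-CriticalPhenomena-CardyFormu-b84f1fb2-0 2026-08-15T11:34:35Z · rev 1 · ledger route-CriticalPhenomena-CardyScaleErgodic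
GENERATED by the gate from the ledger (D-0016/17). Provers cite these decls: `theorem foo : Summit.CriticalPhenomena.CardyFormulaZ2.Theses.CardyScaleErgodic.<Decl> := …` in Summits/CriticalPhenomena/CardyFormulaZ2/Theorems/<Name>.lean.
-/

namespace Summit.CriticalPhenomena.CardyFormulaZ2.Theses.CardyScaleErgodic

open scoped BigOperators Topology Manifold Classical MeasureTheory ProbabilityTheory Matrix InnerProductSpace ComplexConjugate ContinuousMap
open Filter Set Function TopologicalSpace MeasureTheory

attribute [summit_statement] _root_.CardyFormulaZ2

/-- item stmt-CriticalPhenomena-4589 · crux · rank 2 · open · by planner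
why it might fail: A scale-STATIONARY but not scale-invariant Euclidean local domain-Markov ensemble (an RG limit cycle; log-periodic critical amplitudes do occur in hierarchical models, DerridaGiacomin2013) is excluded by no known argument; even for Dirac masses (fixed points) the upgrade is open (CardyRotToConf r2).
sources: Schramm2000, LawlerSchrammWerner2001, Werner2007, KemppainenSmirnov2017, Hochman2010FractalDistributions, Furstenberg2008
[crux] Quenched symmetry upgrade (card scale-ergodic-quenched-upgrade; Schramm2000 §1 +
LawlerSchrammWerner2001 §3 + Werner2007 §3.2, run under scale-STATIONARITY). F = DobrushinDomain →
ProbabilityMeasure (CurveClass ℂ), product of weak topologies; dilation flow (act_t P)(D) = (z ↦ t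
z)_* P(t⁻¹ D) via similarity/MarkedDomain.map. CLAIM: every Borel probability measure ν on F
invariant under all act_t (t > 0) and carried by families that are chordal, covariant under rigid
motions z ↦ c z + w with |c| = 1 (the embedding-specific input), domain-Markov, local,
target-independent and Kemppainen–Smirnov regular (ConditionG2 of {(D, P D)}) is carried by the SLE₆
family: ν-a.e. P, ∀ D, IsSLELaw 6 D (P D). For ν = δ_P this is CardyRotToConf r2 restricted to fixed
points; the quenched generality is exactly what Krylov–Bogolyubov delivers (r3); ergodic
decomposition stays inside the proof (ν invariant, not ergodic). Reading: no RG limit cycle inside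
the translation-invariant local Markov class. The identification half (conformal covariance + Markov
⇒ SLE_κ; locality ⇒ κ = 6) is Schramm's principle + LSW (cf.
eq_six_of_forall_measureReal_hitsBefore). -/
@[route_item "route-CriticalPhenomena-CardyScaleErgodic", crux]
def QuenchedUpgrade : Prop :=
  let F := Literature.Probability.RandomPlanarGeometry.DobrushinDomain → ProbabilityMeasure (Literature.Probability.RandomPlanarGeometry.CurveClass ℂ); let toCF : F → Literature.Probability.RandomPlanarGeometry.ChordalFamily := fun P D => (P D : Measure (Literature.Probability.RandomPlanarGeometry.CurveClass ℂ)); let act : ∀ t : ℝ, 0 < t → F → F := fun t ht P D => (P (D.map (Literature.Probability.RandomPlanarGeometry.similarity ((t : ℂ)⁻¹) (inv_ne_zero (Complex.ofReal_ne_zero.mpr ht.ne')) 0))).map (Literature.Probability.RandomPlanarGeometry.measurable_curveClassMap_similarity (t : ℂ) (Complex.ofReal_ne_zero.mpr ht.ne') 0).aemeasurable; let Euclid : Literature.Probability.RandomPlanarGeometry.ChordalFamily → Prop := fun P => ∀ (D : Literature.Probability.RandomPlanarGeometry.DobrushinDomain) (c : ℂ) (hc : c ≠ 0) (w : ℂ),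 ‖c‖ = 1 → P (D.map (Literature.Probability.RandomPlanarGeometry.similarity c hc w)) = (P D).map (Literature.Probability.RandomPlanarGeometry.CurveClass.map (Literature.Probability.RandomPlanarGeometry.similarity c hc w : C(ℂ, ℂ))); let G2 : Literature.Probability.RandomPlanarGeometry.ChordalFamily → Prop := fun P => Literature.Probability.RandomPlanarGeometry.ConditionG2 (Set.range fun D : Literature.Probability.RandomPlanarGeometry.DobrushinDomain => (⟨D.carrier, D.pt 0, D.pt 1, P D⟩ : Literature.Probability.RandomPlanarGeometry.MarkedLaw)); ∀ ν : Measure[borel F] F, IsProbabilityMeasure ν → (∀ (t : ℝ) (ht : 0 < t), @MeasurePreserving F F (borel F) (borel F) (act t ht) ν ν) → (∀ᵐ P ∂ν, (toCF P).IsChordal ∧ Euclid (toCF P) ∧ (toCF P).IsDomainMarkov ∧ (toCF P).IsLocal ∧ (toCF P).IsTargetIndependent ∧ G2 (toCF P)) → ∀ᵐ P ∂ν, ∀ D : Literature.Probability.RandomPlanarGeometry.DobrushinDomain, Literature.Probability.RandomPlanarGeometry.IsSLELaw 6 D (toCF P D)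

/-- item stmt-CriticalPhenomena-4590 · crux · rank 3 · open · by planner
why it might fail: For ν-EVERY limit family one needs a Cardy-free domain-Markov EXTENSION to slit domains (CamiaNewman2007 Thm 7 proves Markov for subsequential limits VIA Cardy; only the touching control, Rem 7.1, is RSW), G2 for the LIMIT law, DKKMO loop→interface transfer, and the G02 crossing dictionary.
sources: KemppainenSmirnov2017, CamiaNewman2007, DKKMO2020Rotational, AizenmanBurchard1999, GarbanPeteSchramm2013, SchrammSmirnov2011
[crux] CONSTRUCTION statement (the posited object): Borel probability measure ν on F =
DobrushinDomain → ProbabilityMeasure (CurveClass ℂ), invariant under every dilation act_t, carried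
by families satisfying the hypotheses of QuenchedUpgrade AND tied to ℤ²: ν-a.e. P, ∀ R, the
P-probability that the curve of R.chord 0 2 hits (cd) before (bc) is a cluster value at 0⁺ of δ ↦
bondDomainCrossingProb R δ. Proof plan: orbit δ ↦ JOINT law of the full-plane configuration
(SchrammSmirnov2011 Thm 1.4) and of all interfaces bondInterfaceIn D (E_D δ), tight by
Aizenman–Burchard; Krylov–Bogolyubov ⇒ invariant ν on the compact orbit closure; a ν-typical family
is read off ONE limiting coupling (no pathwise measurability of interfaces w.r.t. crossings, GPS13
Q.10, needed), hence chordal, translation- (SchrammSmirnov2011 §1) and rotation-covariant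
(DKKMO2020Rotational Thm 1.4), local/target-independent/Markov (exact on the lattice; touching
control as in CamiaNewman2007 Rem 7.1; a Cardy-free Markov EXTENSION over all pasts is the delicate
point), G2 (KemppainenSmirnov2017 Thm 1.3, §4.2), tied (hitsBefore null frontier + boundary
insensitivity: cf. CardyViaSLE6 stmt-0754/0755). Not free: ν = δ_SLE₆ -/
@[route_item "route-CriticalPhenomena-CardyScaleErgodic", crux]
def ScaleStationaryEnsemble : Prop :=
  let F := Literature.Probability.RandomPlanarGeometry.DobrushinDomain → ProbabilityMeasure (Literature.Probability.RandomPlanarGeometry.CurveClass ℂ); let toCF : F → Literature.Probability.RandomPlanarGeometry.ChordalFamily := fun P D => (P D : Measure (Literature.Probability.RandomPlanarGeometry.CurveClass ℂ)); let act : ∀ t : ℝ, 0 < t → F → F := fun t ht P D => (P (D.map (Literature.Probability.RandomPlanarGeometry.similarity ((t : ℂ)⁻¹) (inv_ne_zero (Complex.ofReal_ne_zero.mpr ht.ne')) 0))).map (Literature.Probability.RandomPlanarGeometry.measurable_curveClassMap_similarity (t : ℂ) (Complex.ofReal_ne_zero.mpr ht.ne') 0).aemeasurable; let Euclid : Literature.Probability.RandomPlanarGeometry.ChordalFamily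 → Prop := fun P => ∀ (D : Literature.Probability.RandomPlanarGeometry.DobrushinDomain) (c : ℂ) (hc : c ≠ 0) (w : ℂ), ‖c‖ = 1 → P (D.map (Literature.Probability.RandomPlanarGeometry.similarity c hc w)) = (P D).map (Literature.Probability.RandomPlanarGeometry.CurveClass.map (Literature.Probability.RandomPlanarGeometry.similarity c hc w : C(ℂ, ℂ))); let G2 : Literature.Probability.RandomPlanarGeometry.ChordalFamily → Prop := fun P => Literature.Probability.RandomPlanarGeometry.ConditionG2 (Set.range fun D : Literature.Probability.RandomPlanarGeometry.DobrushinDomain => (⟨D.carrier, D.pt 0, D.pt 1, P D⟩ : Literature.Probability.RandomPlanarGeometry.MarkedLaw)); ∃ ν : Measure[borel F] F, IsProbabilityMeasure ν ∧ (∀ (t : ℝ) (ht : 0 < t), @MeasurePreserving F F (borel F) (borel F) (act t ht) ν ν) ∧ (∀ᵐ P ∂ν, (toCF P).IsChordal ∧ Euclid (toCF P) ∧ (toCF P).IsDomainMarkov ∧ (toCF P).IsLocal ∧ (toCF P).IsTargetIndependent ∧ G2 (toCF P)) ∧ (∀ᵐ P ∂ν, ∀ R : Literature.Probability.RandomPlanarGeometry.ConformalRectangle,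 MapClusterPt ((toCF P (R.chord 0 2 (by decide))).real (Literature.Probability.RandomPlanarGeometry.CurveClass.hitsBefore (R.arc 2) (R.arc 1))) (𝓝[>] (0 : ℝ)) (Literature.Probability.Percolation.bondDomainCrossingProb R))

/-- item stmt-CriticalPhenomena-0747 · crux · rank 4 · open · by planner
why it might fail: Only RSW is known: cluster points in (0,1) (discreteCrossingProb_clusterPt_mem_Ioo_holds); no monotonicity or sub-multiplicativity in δ, so p(δ) may oscillate between two cluster points (δ = 2^-k vs 3^-k). Open: Grimmett1999 §11.10, BollobasRiordan2006 Ch. 7 Conj. 1.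
sources: Grimmett1999, BollobasRiordan2006, lean:Literature.Probability.Percolation.discreteCrossingProb_clusterPt_mem_Ioo, lean:Summit.CriticalPhenomena.CardyFormulaZ2.Theses.CardyUniqueLimit.LimitExists
[crux] Existence of the scaling limit of bond-Z^2 crossing probabilities at p=1/2 for every
conformal rectangle (no identification, no conformal invariance). Open (Grimmett1999 §9.7
conjecture; only RSW bounds on cluster points are known: discreteCrossingProb_clusterPt_mem_Ioo).
Necessary for the conjunct. -/
@[route_item "route-CriticalPhenomena-CardyScaleErgodic", crux]
def LimitExists : Prop :=
  ∀ R : Literature.Probability.RandomPlanarGeometry.ConformalRectangle, ∃ L : ℝ, Filter.Tendsto (Literature.Probability.Percolation.bondDomainCrossingProb R) (nhdsWithin 0 (Set.Ioi 0)) (nhds L)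

/-- item stmt-CriticalPhenomena-4591 · support · rank 6 · open · by planner
[support] The unconditional pay-off of the line: for every conformal rectangle R and uniformizing
datum (φ, x), Cardy's value cardyFunction (crossRatio x) is a CLUSTER VALUE at 0⁺ of δ ↦
bondDomainCrossingProb R δ (MapClusterPt along 𝓝[>] 0). Follows from QuenchedUpgrade ∧
ScaleStationaryEnsemble by PayoffGlue (pure logic + sle_six_measureReal_hitsBefore_holds; checked in
the planner sketch); with LimitExists it gives CardyFormulaZ2 (uniqueness of limits in a T2 space;
checked). Implied by CardyFormulaZ2; numerically unassailable (crossing probabilities on ℤ² match F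
to 1e-3, cf. CardyUniqueLimit sources); filed so that the first unconditional theorem of the route
has a name. Smirnov2001 Thm 1 is the 𝕋 statement with convergence. -/
@[route_item "route-CriticalPhenomena-CardyScaleErgodic", crux]
def ClusterCardyZ2 : Prop :=
  ∀ (R : Literature.Probability.RandomPlanarGeometry.ConformalRectangle) (φ : Literature.Probability.RandomPlanarGeometry.ConformalEquiv UpperHalfPlane.upperHalfPlaneSet R.carrier) (x : Fin 4 → ℝ), R.IsUniformizing φ x → MapClusterPt (Literature.Probability.RandomPlanarGeometry.cardyFunction (Literature.Probability.RandomPlanarGeometry.crossRatio x)) (𝓝[>] (0 : ℝ)) (Literature.Probability.Percolation.bondDomainCrossingProb R)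

/-- item stmt-CriticalPhenomena-4592 · support · rank 7 · open · by planner
[support] Averaged Cardy formula (stronger pay-off, same mechanism): for every conformal rectangle
R, uniformizing datum (φ, x), δ₀ > 0 and ρ ∈ (0,1), the Cesàro means (1/N) Σ_{k<N}
bondDomainCrossingProb R (δ₀ ρ^k) converge to cardyFunction (crossRatio x) — Cardy holds on average
over logarithmic scales. Derivation: QuenchedUpgrade for EVERY flow-invariant ν carried by the orbit
closure (not just one) = unique ergodicity of the dilation flow on Λ with the fixed point SLE₆ ⇒
every weak-* limit of the empirical measures of the discrete-time orbit k ↦ P_{δ₀ρ^k} (a Φ_{log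
1/ρ}-invariant measure whose flow-average is invariant, hence δ_SLE₆, an extreme point) is δ_SLE₆ ⇒
Cesàro convergence of the tied crossing values (Furstenberg2008 / Hochman2010FractalDistributions
style). CesaroCardyZ2 → LimitExists → CardyFormulaZ2 equally closes the conjunct
(Filter.Tendsto.cesaro). Refutable by certified numerics (transfer matrices at meshes 2^-k) only if
Cardy itself fails. -/
@[route_item "route-CriticalPhenomena-CardyScaleErgodic", crux]
def CesaroCardyZ2 : Prop :=
  ∀ (R : Literature.Probability.RandomPlanarGeometry.ConformalRectangle) (φ : Literature.Probability.RandomPlanarGeometry.ConformalEquiv UpperHalfPlane.upperHalfPlaneSet R.carrier) (x : Fin 4 → ℝ), R.IsUniformizing φ x → ∀ (δ₀ ρ : ℝ), 0 < δ₀ → 0 < ρ → ρ < 1 → Filter.Tendsto (fun N : ℕ => (N : ℝ)⁻¹ * ∑ k ∈ Finset.range N, Literature.Probability.Percolation.bondDomainCrossingProb R (δ₀ * ρ ^ k)) Filter.atTop (nhds (Literature.Probability.RandomPlanarGeometry.cardyFunction (Literature.Probability.RandomPlanarGeometry.crossRatio x)))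

/-- item stmt-CriticalPhenomena-4593 · support · rank 8 · open · by planner
[support] Glue, provable NOW (planner sketch: 8 lines): QuenchedUpgrade → ScaleStationaryEnsemble →
ClusterCardyZ2. Take ν from the ensemble; QuenchedUpgrade makes ν-a.e. P the SLE₆ family; ae of a
probability measure is NeBot, so some P is simultaneously SLE₆ in every Dobrushin domain and tied to
the ℤ² crossing cluster values; sle_six_measureReal_hitsBefore_holds (Literature, proved: SLE₆ in
(Ω; a, c) hits (cd) before (bc) with probability F(η)) turns the tie into MapClusterPt
(cardyFunction (crossRatio x)) (𝓝[>] 0) (bondDomainCrossingProb R). -/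
@[route_item "route-CriticalPhenomena-CardyScaleErgodic", crux]
def PayoffGlue : Prop :=
  QuenchedUpgrade → ScaleStationaryEnsemble → ClusterCardyZ2

/-- item stmt-CriticalPhenomena-4594 · assembly · rank 1 · open · by planner
[assembly] QuenchedUpgrade → ScaleStationaryEnsemble → LimitExists → CardyFormulaZ2. Proof (checked
in the planner sketch, modulo the cruxes): PayoffGlue gives ClusterCardyZ2; for R, φ, x uniformizing
let L be the limit from LimitExists; F(η) is a cluster point of the filter map, which is ≤ 𝓝 L, so
ClusterPt (F η) (𝓝 L) and F(η) = L by t2_iff_nhds; hence R.HasCrossingLimit (bondDomainCrossingProb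
R) cardyFunction. Literature input: sle_six_measureReal_hitsBefore_holds only. -/
@[route_item "route-CriticalPhenomena-CardyScaleErgodic", crux]
def Assembly : Prop :=
  QuenchedUpgrade → ScaleStationaryEnsemble → LimitExists → CardyFormulaZ2

/-! D-0027 §2.1 — DECIDING THEOREM (planner-authored via `route open/edit --closes-file`; by operator:999:2941348 2026-08-15T15:19:50Z):
its hypotheses are this route's items and its conclusion the sub-problem Statement (glue_lint), and it elaborates with this file. -/

@[closes "route-CriticalPhenomena-CardyScaleErgodic"] theorem closes : QuenchedUpgrade → ScaleStationaryEnsemble → LimitExists → ClusterCardyZ2 → CesaroCardyZ2 → PayoffGlue → Assembly → _root_.CardyFormulaZ2 := fun h_QuenchedUpgrade h_ScaleStationaryEnsemble h_LimitExists h_ClusterCardyZ2 h_CesaroCardyZ2 h_PayoffGlue h_Assembly => h_Assembly h_QuenchedUpgrade h_ScaleStationaryEnsemble h_LimitExists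

end Summit.CriticalPhenomena.CardyFormulaZ2.Theses.CardyScaleErgodic
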